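import Mathlib
import HarnessLib.Audit
import Summits.PneNP.PneNP.Theorems.ClusUniversalCertificateTreeCount

/-!
# Route ClusUniversalCertificate — TREE-COUNT, set version: `TCSmin`, local saturation `LSPmin`, and the static target `TIIF`
(rung F-N1, cell pnp-ideate, planner p1 g12 ROUND-12 "TREE-COUNT programme"; landing of the planner's sorry-free file
`HOME/pnp-ideate-p1/lines/treecount-TCS-UNREGISTERED.lean` sha16 `007948cc58786841`, referee SCOREs 139 / 142 PASS, ROUND-12.md §2 / §7 T1 —
statements byte-faithful, second half: lines 344–632; the fluid version `TCMmin` and the chain to the crux are in `ClusUniversalCertificateTreeCount`)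

The SET version `TCSmin M` of the tree count (each point puts at most one unit on each edge of its root path; a shipment is
`f : (Fin M → ZMod 2) → ℕ → Bool`, `shipOK` mirrors the recursion of `tcMin` with the min-capacities `μ`), shown to imply the fluid `TCMmin`
(`tcsMin_gives_tcmMin`).  LOCAL SATURATION `LSPmin M` (`lspOK`: inside every class each point carries at least its local demand on the edges
strictly below the class — ROUND-12 P11) with `lspMin_gives_tcsMin`.  (The compositions with the route decl `UniversalCertAll` —
`universalCertAll_of_tcsMin`, `universalCertAll_of_lspMin` — live in `ClusUniversalCertificateTreeCountCloses`, keeping this file route-independent.)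
The typed STATIC TARGET `TIIF M` (TII-F, the all-edges case of the recursive Hall form of LSP — lines/lsp-P11.md §2b) with `tiif_gives_tii :
TIIF M → TIIsum M` and `lspMin_gives_tiif : LSPmin M → TIIF M`.

TYPED LATTICE (all arrows kernel-checked in these two files): `LSPmin → TCSmin → TCMmin → TCMId → UCMixDim → UniversalCertAll`;
`LSPmin → TIIF → TIIsum`; `TCMmin → TIIsum`.  OPEN nodes: `LSPmin` (ROUND-12 P11, via the mandatory bound (M)), `TIIF` (= the rising-point
bound RPB, static), `TCSmin`, `TCMmin` — conjectural sufficient conditions; census and evidence in ROUND-12.md §3 / ROUND-13.md.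

ROUTE-INDEPENDENT (no `Theses` import) objects and arrows for an OPEN crux of route ClusUniversalCertificate.  HONEST FRAMING: FRONTIER rung
F-N1, restricted-model combinatorics — nothing here bears on `P` versus `NP`.
-/

set_option linter.dupNamespace false -- `Summit.PneNP.PneNP.…`: summit = sub-problem name (D-0017 single-conjunct layout)

namespace Summit.PneNP.PneNP.Theorems.ClusCoord

open Finset

/-! ## The SET version TCS-min (each point puts at most one unit on each edge of its root path) — typed, and shown to imply the
fluid `TCMmin`.  A shipment is `f : (Fin M → ZMod 2) → ℕ → Bool`: `f y j = true` means `y` puts one unit on the edge into its own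
class at block-level `j` (the class obtained by fixing blocks `0,…,j`).  `shipOK` mirrors the recursion of `tcMin`: at a class `C` with
`k+1` blocks to go (block `j = n-(k+1)` queried) every value-child `C_v` carries at most `μ(C) = muMin blk j C` units on its edge. -/

/-- number of units `y` places at block-levels `< m` (i.e. on the edges above its level-`m` class). -/
def unitsAbove {M : ℕ} (f : (Fin M → ZMod 2) → ℕ → Bool) (y : Fin M → ZMod 2) (m : ℕ) : ℕ :=
  ((Finset.range m).filter fun j => f y j = true).card

/-- capacity-feasibility of a shipment, recursively down the class tree (same recursion shape as `tcMin`). -/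
def shipOK {M : ℕ} (n : ℕ) (blk : Fin M → Fin n) (f : (Fin M → ZMod 2) → ℕ → Bool) :
    ℕ → Finset (Fin M → ZMod 2) → Prop
  | 0, _ => True
  | k + 1, C => ∀ v ∈ C.image (projN blk (n - (k + 1))),
      ((C.filter fun y => projN blk (n - (k + 1)) y = v).filter fun y => f y (n - (k + 1)) = true).card
          ≤ muMin blk (n - (k + 1)) C ∧
        shipOK n blk f k (C.filter fun y => projN blk (n - (k + 1)) y = v)

/-- `TCSmin M` (set version of TCM-min): some 0/1 shipment meets every demand `e⁺(y)` with units on DISTINCT edges of `y`'s root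
path and respects the min-capacities.  Formally stronger than the fluid `TCMmin M` (next theorem); ROUND-12 P10/P11 live here. -/
@[conjecture] def TCSmin (M : ℕ) : Prop :=
  ∀ n : ℕ, ∀ blk : Fin M → Fin n, ∀ Y : Finset (Fin M → ZMod 2),
    ∃ f : (Fin M → ZMod 2) → ℕ → Bool,
      (∀ y ∈ Y, eplus M n blk Y y ≤ (unitsAbove f y n : ℤ)) ∧ shipOK n blk f n Y

/-- one more level: `unitsAbove f y (m+1) = unitsAbove f y m + [f y m]`. -/
theorem unitsAbove_succ {M : ℕ} (f : (Fin M → ZMod 2) → ℕ → Bool) (y : Fin M → ZMod 2) (m : ℕ) :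
    unitsAbove f y (m + 1) = unitsAbove f y m + (if f y m = true then 1 else 0) := by
  unfold unitsAbove
  rw [Finset.range_add_one, Finset.filter_insert]
  split_ifs with h
  · rw [Finset.card_insert_of_notMem (by simp)]
  · simp

/-- the fluid recursion is dominated by the units a feasible 0/1 shipment places above each class. -/
theorem tcMin_le_unitsAbove (M n : ℕ) (blk : Fin M → Fin n) (Y : Finset (Fin M → ZMod 2))
    (f : (Fin M → ZMod 2) → ℕ → Bool) (hdem : ∀ y ∈ Y, eplus M n blk Y y ≤ (unitsAbove f y n : ℤ)) :
    ∀ k, k ≤ n → ∀ C, C ⊆ Y → shipOK n blk f k C →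
      tcMin M n blk Y k C ≤ ∑ y ∈ C, (unitsAbove f y (n - k) : ℤ) := by
  intro k
  induction k with
  | zero =>
    intro _ C hC _
    simp only [tcMin, Nat.sub_zero]
    exact Finset.sum_le_sum fun y hy => hdem y (hC hy)
  | succ k ih =>
    intro hk C hC hOK
    simp only [tcMin]
    set p := projN blk (n - (k + 1)) with hp
    have hnk : n - k = (n - (k + 1)) + 1 := by omega
    have hsplit : ∑ y ∈ C, (unitsAbove f y (n - (k + 1)) : ℤ) =
        ∑ v ∈ C.image p, ∑ y ∈ C.filter (fun y => p y = v), (unitsAbove f y (n - (k + 1)) : ℤ) :=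
      (Finset.sum_fiberwise_of_maps_to (fun y hy => Finset.mem_image_of_mem p hy) _).symm
    rw [hsplit]
    apply Finset.sum_le_sum
    intro v hv
    have hOKv := hOK v hv
    set Cv := C.filter (fun y => p y = v) with hCv
    have hCvY : Cv ⊆ Y := fun y hy => hC (Finset.mem_filter.mp hy).1
    have h1 := ih (by omega) Cv hCvY hOKv.2
    rw [hnk] at h1
    have h2 : ∑ y ∈ Cv, (unitsAbove f y ((n - (k + 1)) + 1) : ℤ)
        = ∑ y ∈ Cv, (unitsAbove f y (n - (k + 1)) : ℤ)
          + ∑ y ∈ Cv, (if f y (n - (k + 1)) = true then (1 : ℤ) else 0) := by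
      rw [← Finset.sum_add_distrib]
      apply Finset.sum_congr rfl
      intro y _
      simp only [unitsAbove_succ, Nat.cast_add, Nat.cast_ite, Nat.cast_one, Nat.cast_zero]
    have h3 : ∑ y ∈ Cv, (if f y (n - (k + 1)) = true then (1 : ℤ) else 0)
        = ((Cv.filter fun y => f y (n - (k + 1)) = true).card : ℤ) := by
      simp [Finset.sum_boole]
    have h4 : ((Cv.filter fun y => f y (n - (k + 1)) = true).card : ℤ) ≤ (muMin blk (n - (k + 1)) C : ℤ) := by
      exact_mod_cast hOKv.1
    have h5 : 0 ≤ ∑ y ∈ Cv, (unitsAbove f y (n - (k + 1)) : ℤ) :=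
      Finset.sum_nonneg fun y _ => by positivity
    rw [h2, h3] at h1
    apply max_le h5
    linarith

/-- SET version ⟹ FLUID version. -/
theorem tcsMin_gives_tcmMin (M : ℕ) : TCSmin M → TCMmin M := by
  intro h n blk Y
  obtain ⟨f, hdem, hOK⟩ := h n blk Y
  have := tcMin_le_unitsAbove M n blk Y f hdem n le_rfl Y (fun _ hy => hy) hOK
  simpa [unitsAbove] using this


/-! ## LOCAL SATURATION (LSP), typed.  `lspOK` adds to `shipOK` the hereditary clause: inside EVERY class `C` (with `k` blocks to go) each
`y ∈ C` carries at least its LOCAL demand `(M − acodim M C y − Σ_{j ≥ n-k} (bsize j − 1))⁺` on the edges strictly below `C`.  ROUND-12 P11: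
the mandatory-first greedy G* constructs such a shipment whenever the mandatory bound (M) holds; `LSPmin → TCSmin` is immediate. -/

/-- number of units `y` places at block-levels in `[a, n)` (the edges strictly below its level-`a` class). -/
def unitsBelow {M : ℕ} (f : (Fin M → ZMod 2) → ℕ → Bool) (y : Fin M → ZMod 2) (a n : ℕ) : ℕ :=
  ((Finset.Ico a n).filter fun j => f y j = true).card

/-- local demand of `y` inside the class `C` whose subtree consists of the block-levels `[a, n)`. -/
noncomputable def localDemand (M n : ℕ) (blk : Fin M → Fin n) (a : ℕ) (C : Finset (Fin M → ZMod 2)) (y : Fin M → ZMod 2) : ℤ :=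
  max 0 (((M : ℤ) - (acodim M C y : ℤ)) - ∑ j ∈ Finset.Ico a n, ((bsizeN blk j : ℤ) - 1))

/-- hereditary local-demand clause, recursively down the class tree. -/
def lspOK (M n : ℕ) (blk : Fin M → Fin n) (f : (Fin M → ZMod 2) → ℕ → Bool) :
    ℕ → Finset (Fin M → ZMod 2) → Prop
  | 0, _ => True
  | k + 1, C => (∀ y ∈ C, localDemand M n blk (n - (k + 1)) C y ≤ (unitsBelow f y (n - (k + 1)) n : ℤ)) ∧
      ∀ v ∈ C.image (projN blk (n - (k + 1))),
        lspOK M n blk f k (C.filter fun y => projN blk (n - (k + 1)) y = v)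

/-- `LSPmin M`: a capacity-feasible 0/1 shipment meeting the demand of every point inside every class of the tree (local saturation). -/
@[conjecture] def LSPmin (M : ℕ) : Prop :=
  ∀ n : ℕ, ∀ blk : Fin M → Fin n, ∀ Y : Finset (Fin M → ZMod 2),
    ∃ f : (Fin M → ZMod 2) → ℕ → Bool,
      (∀ y ∈ Y, eplus M n blk Y y ≤ (unitsAbove f y n : ℤ)) ∧ shipOK n blk f n Y ∧ lspOK M n blk f n Y

/-- local saturation is (formally) stronger than the set version. -/
theorem lspMin_gives_tcsMin (M : ℕ) : LSPmin M → TCSmin M := by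
  intro h n blk Y
  obtain ⟨f, hdem, hOK, _⟩ := h n blk Y
  exact ⟨f, hdem, hOK⟩


/-! ## TII-F (typed target; the all-edges case of the recursive Hall form of LSP — ROUND-12 lines/lsp-P11.md §2b).  For a class `C`
(`k+1` blocks to go, block `j = n-(k+1)` queried) and each value-child `C_v`: the local demand MEASURED IN THE PARENT of the points of `C_v` is at
most `μ(C) + cap(subtree C_v)`.  m = 1 reading: `Σ_{y ∈ Q_c} dim_S(y) ≤ min(|Q_0|,|Q_1|) + 2·Σ_{P ⊆ Q_c} min(|P_0|,|P_1|)`.  Necessary for `LSPmin` (paper);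
0 violations and tight at 55–100 % of edges in all data (tools-g12/tiif.py, tiif_block.py); NOT implied by `TIIsum` plus counting.  OPEN. -/

/-- hereditary TII-F clause down the class tree. -/
def tiifOK (M n : ℕ) (blk : Fin M → Fin n) : ℕ → Finset (Fin M → ZMod 2) → Prop
  | 0, _ => True
  | k + 1, C => ∀ v ∈ C.image (projN blk (n - (k + 1))),
      (∑ y ∈ (C.filter fun y => projN blk (n - (k + 1)) y = v), localDemand M n blk (n - (k + 1)) C y
          ≤ (muMin blk (n - (k + 1)) C : ℤ) + tiiCap M n blk k (C.filter fun y => projN blk (n - (k + 1)) y = v)) ∧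
        tiifOK M n blk k (C.filter fun y => projN blk (n - (k + 1)) y = v)

/-- `TIIF M`: TII-F at every edge of every class tree (identity block order, every block map). -/
@[conjecture] def TIIF (M : ℕ) : Prop :=
  ∀ n : ℕ, ∀ blk : Fin M → Fin n, ∀ Y : Finset (Fin M → ZMod 2), tiifOK M n blk n Y


/-- the root clause of `localDemand` is the leaf demand `eplus`. -/
theorem localDemand_top (M n : ℕ) (blk : Fin M → Fin n) (Y : Finset (Fin M → ZMod 2)) (y : Fin M → ZMod 2) :
    localDemand M n blk (n - n) Y y = eplus M n blk Y y := by
  unfold localDemand eplus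
  rw [Nat.sub_self, ← Finset.range_eq_Ico, ← Fin.sum_univ_eq_sum_range (fun j => ((bsizeN blk j : ℤ) - 1)) n]
  simp only [bsizeN_eq_bsize]

/-- TII-F refines TII: summing the TII-F clause over the value-children of the root gives `TIIsum`. -/
theorem tiif_gives_tii (M : ℕ) : TIIF M → TIIsum M := by
  intro h n blk Y
  cases n with
  | zero =>
    simp only [tiiCap]
    apply Finset.sum_nonpos
    intro y _
    rcases Nat.eq_zero_or_pos M with hM | hM
    · subst hM
      simp [eplus]
    · exact Fin.elim0 (blk ⟨0, hM⟩)
  | succ k =>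
    have hT : tiifOK M (k + 1) blk (k + 1) Y := h (k + 1) blk Y
    simp only [tiifOK] at hT
    simp only [tiiCap]
    set p := projN blk (k + 1 - (k + 1)) with hp
    have hsplit : ∑ y ∈ Y, eplus M (k + 1) blk Y y =
        ∑ v ∈ Y.image p, ∑ y ∈ Y.filter (fun y => p y = v), eplus M (k + 1) blk Y y :=
      (Finset.sum_fiberwise_of_maps_to (fun y hy => Finset.mem_image_of_mem p hy) _).symm
    rw [hsplit]
    have h3 : ∀ v ∈ Y.image p,
        ∑ y ∈ Y.filter (fun y => p y = v), eplus M (k + 1) blk Y y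
          ≤ (muMin blk (k + 1 - (k + 1)) Y : ℤ) + tiiCap M (k + 1) blk k (Y.filter fun y => p y = v) := by
      intro v hv
      have := (hT v hv).1
      simp only [localDemand_top] at this
      exact this
    have h4 := Finset.sum_le_sum h3
    rw [Finset.sum_add_distrib, Finset.sum_const, nsmul_eq_mul] at h4
    exact h4


/-! ## `LSPmin → TIIF` (a feasible locally-saturating shipment certifies TII-F): the local demand of the points of a value-child, measured
in the parent, is carried on the child's edge (≤ μ) and inside the child's subtree (≤ its total capacity). -/

/-- peeling the top level of `unitsBelow`: `[f y a] + unitsBelow f y (a+1) n`. -/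
theorem unitsBelow_succ_left {M : ℕ} (f : (Fin M → ZMod 2) → ℕ → Bool) (y : Fin M → ZMod 2) {a n : ℕ} (h : a < n) :
    unitsBelow f y a n = (if f y a = true then 1 else 0) + unitsBelow f y (a + 1) n := by
  unfold unitsBelow
  have hI : Finset.Ico a n = insert a (Finset.Ico (a + 1) n) := by
    ext x; simp only [Finset.mem_Ico, Finset.mem_insert]; omega
  rw [hI, Finset.filter_insert]
  have hna : a ∉ (Finset.Ico (a + 1) n).filter (fun j => f y j = true) := by simp
  split_ifs with hf
  · rw [Finset.card_insert_of_notMem hna]; omega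
  · simp

/-- total units inside a subtree are bounded by its total capacity. -/
theorem unitsBelow_le_tiiCap (M n : ℕ) (blk : Fin M → Fin n) (f : (Fin M → ZMod 2) → ℕ → Bool) :
    ∀ k, k ≤ n → ∀ C : Finset (Fin M → ZMod 2), shipOK n blk f k C →
      ∑ y ∈ C, (unitsBelow f y (n - k) n : ℤ) ≤ tiiCap M n blk k C := by
  intro k
  induction k with
  | zero =>
    intro _ C _
    simp [unitsBelow, tiiCap]
  | succ k ih =>
    intro hk C hOK
    simp only [tiiCap]
    set p := projN blk (n - (k + 1)) with hp
    have hlt : n - (k + 1) < n := by omega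
    have hnk : n - (k + 1) + 1 = n - k := by omega
    have hsplit : ∑ y ∈ C, (unitsBelow f y (n - (k + 1)) n : ℤ) =
        ∑ v ∈ C.image p, ∑ y ∈ C.filter (fun y => p y = v), (unitsBelow f y (n - (k + 1)) n : ℤ) :=
      (Finset.sum_fiberwise_of_maps_to (fun y hy => Finset.mem_image_of_mem p hy) _).symm
    rw [hsplit]
    have h3 : ∀ v ∈ C.image p,
        ∑ y ∈ C.filter (fun y => p y = v), (unitsBelow f y (n - (k + 1)) n : ℤ)
          ≤ (muMin blk (n - (k + 1)) C : ℤ) + tiiCap M n blk k (C.filter fun y => p y = v) := by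
      intro v hv
      set Cv := C.filter (fun y => p y = v) with hCv
      have h1 : ∑ y ∈ Cv, (unitsBelow f y (n - (k + 1)) n : ℤ)
          = ∑ y ∈ Cv, (if f y (n - (k + 1)) = true then (1 : ℤ) else 0)
            + ∑ y ∈ Cv, (unitsBelow f y (n - k) n : ℤ) := by
        rw [← Finset.sum_add_distrib]
        apply Finset.sum_congr rfl
        intro y _
        rw [unitsBelow_succ_left f y hlt, hnk]
        simp only [Nat.cast_add, Nat.cast_ite, Nat.cast_one, Nat.cast_zero]
      have h2 : ∑ y ∈ Cv, (if f y (n - (k + 1)) = true then (1 : ℤ) else 0)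
          = ((Cv.filter fun y => f y (n - (k + 1)) = true).card : ℤ) := by
        simp [Finset.sum_boole]
      have h4 : ((Cv.filter fun y => f y (n - (k + 1)) = true).card : ℤ) ≤ (muMin blk (n - (k + 1)) C : ℤ) := by
        exact_mod_cast (hOK v hv).1
      have h5 := ih (by omega) Cv (hOK v hv).2
      rw [h1, h2]
      linarith
    have h6 := Finset.sum_le_sum h3
    rw [Finset.sum_add_distrib, Finset.sum_const, nsmul_eq_mul] at h6
    exact h6

/-- the hereditary TII-F clause follows from a locally saturating feasible shipment. -/
theorem tiifOK_of_lsp (M n : ℕ) (blk : Fin M → Fin n) (f : (Fin M → ZMod 2) → ℕ → Bool) :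
    ∀ k, k ≤ n → ∀ C : Finset (Fin M → ZMod 2), shipOK n blk f k C → lspOK M n blk f k C → tiifOK M n blk k C := by
  intro k
  induction k with
  | zero => intro _ C _ _; simp [tiifOK]
  | succ k ih =>
    intro hk C hS hL
    simp only [tiifOK]
    intro v hv
    set p := projN blk (n - (k + 1)) with hp
    set Cv := C.filter (fun y => p y = v) with hCv
    have hlt : n - (k + 1) < n := by omega
    have hnk : n - (k + 1) + 1 = n - k := by omega
    simp only [shipOK] at hS
    simp only [lspOK] at hL
    refine ⟨?_, ih (by omega) Cv (hS v hv).2 (hL.2 v hv)⟩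
    -- local demand ≤ units below C (clause at C), split into the edge unit and the units inside subtree(Cv)
    have hdem : ∑ y ∈ Cv, localDemand M n blk (n - (k + 1)) C y ≤ ∑ y ∈ Cv, (unitsBelow f y (n - (k + 1)) n : ℤ) := by
      apply Finset.sum_le_sum
      intro y hy
      exact hL.1 y (Finset.mem_filter.mp hy).1
    have h1 : ∑ y ∈ Cv, (unitsBelow f y (n - (k + 1)) n : ℤ)
        = ∑ y ∈ Cv, (if f y (n - (k + 1)) = true then (1 : ℤ) else 0)
          + ∑ y ∈ Cv, (unitsBelow f y (n - k) n : ℤ) := by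
      rw [← Finset.sum_add_distrib]
      apply Finset.sum_congr rfl
      intro y _
      rw [unitsBelow_succ_left f y hlt, hnk]
      simp only [Nat.cast_add, Nat.cast_ite, Nat.cast_one, Nat.cast_zero]
    have h2 : ∑ y ∈ Cv, (if f y (n - (k + 1)) = true then (1 : ℤ) else 0)
        = ((Cv.filter fun y => f y (n - (k + 1)) = true).card : ℤ) := by
      simp [Finset.sum_boole]
    have h4 : ((Cv.filter fun y => f y (n - (k + 1)) = true).card : ℤ) ≤ (muMin blk (n - (k + 1)) C : ℤ) := by
      exact_mod_cast (hS v hv).1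
    have h5 := unitsBelow_le_tiiCap M n blk f k (by omega) Cv (hS v hv).2
    rw [h1, h2] at hdem
    linarith

/-- LOCAL SATURATION certifies TII-F. -/
theorem lspMin_gives_tiif (M : ℕ) : LSPmin M → TIIF M := by
  intro h n blk Y
  obtain ⟨f, _, hS, hL⟩ := h n blk Y
  exact tiifOK_of_lsp M n blk f n le_rfl Y hS hL

end Summit.PneNP.PneNP.Theorems.ClusCoord
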